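import Mathlib
import HarnessLib
import Summits.MatrixMultiplication.MatrixMultiplication.Theses.OutsiderSandwich
import Summits.MatrixMultiplication.MatrixMultiplication.Theorems.OutsiderSandwichLaserFloor

/-!
# OutsiderSandwich — the laser floor, part 2/3: transport of the two pieces of the cut to `Δ(ℂ)`

(decomp-mm lens-4, gen 11; notation and overview in part 1, `OutsiderSandwichLaserFloor`.)
With `τ_F := log₂ F(⟨2,2,2⟩)`, `x_F := log₂ F(cw₂)`, floor `x = log₂3 + (τ−2)/3` and the chord of
slope `ℓ(ω)/2 = 1/3 + (log₂3 − 2/3)/ω` through the origin of the `(τ, x)`-plane: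

* §4 `laserMergeOptimal_of_attained` — chord form `LaserFloorAttained ⟹ LaserMergeOptimal` (apply `F`
  to `⟨m,m,m⟩ ≤ cw₂^{⊠N}`: `m^{τ_F} ≤ F(cw₂)^N`);
* §6 `summit_of_laserFloor` — `LaserFloorStrict → LaserFloorAttained → ω = 2` (the chord lies below the
  floor by `(log₂3 − 2/3)(1 − τ/ω)`, so a near-chord point has `τ_F` near `ω`; if `ω > 2` it violates the
  strict floor);
* §7 `strict_of_laserTangency` — `LaserTangency ⟹ LaserFloorStrict` (and the hybrid cut
  `summit_of_laserTangency_of_attained`)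
  (apply `F` to ONE capped cell `⟨B⟩ ⊗ ⟨m,m,m⟩ ≤ cw₂^{⊠N}`: with `s·τ_F/2 ≥ 1 + c` the cap
  `B ≤ 2^{bN}`, `b < log₂3 − 2/3`, pays a premium `Γ(b)·min(η,1)/8`, `Γ(b) = ln 3 − (2/3 + b) ln 2 > 0`).

Part 3 (`OutsiderSandwichLaserFloorTop`) proves the necessity of both pieces under `ω = 2`, the ω-free
letter `LaserTightAtTop` of attainment, and the route items `SummitIffLaserFloor` / `LaserFloorTransport`.
All sorry-free.  Sources as in part 1.
-/

set_option linter.dupNamespace false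

namespace Summit.MatrixMultiplication.MatrixMultiplication.Theorems.OutsiderSandwichLaserFloorCut

open scoped BigOperators Topology
open Filter
open Literature.Computability.AlgebraicComplexity
open Literature.Barriers.MatrixMultiplication (logb_two_mul_log_le_log IsAdequate)
open Summit.MatrixMultiplication.MatrixMultiplication.Theses.OutsiderSandwich
  (LaserMergeOptimal LaserTangency PerfectAtLaser)
open Summit.MatrixMultiplication.MatrixMultiplication.Theorems.OutsiderSandwichLaserFloor

variable {F : SpectralMap ℂ}

/-! ## 3½. `τ_F ≤ ω ≤ 3` (Strassen duality) and `F(cw₂) ≥ 3 = Q̃(cw₂)` (the floor at `τ_F ≥ 2`) -/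

/-- `τ_F ≤ ω` (Strassen duality: `F(⟨2,2,2⟩) ≤ R̃(⟨2,2,2⟩) = 2^ω`). -/
theorem matExp_le_omega (hF : IsUniversalSpectralPoint ℂ F) :
    Real.logb 2 (F (matMulTensor ℂ 2 2 2)) ≤ omega ℂ := by
  have h1 := (strassen_duality_asymptoticRank_holds ℂ (matMulTensor ℂ 2 2 2)).1 F hF
  rw [asymptoticRank_matMulTensor ℂ 2 (by norm_num)] at h1
  push_cast at h1
  have h0 : 0 < F (matMulTensor ℂ 2 2 2) := lt_of_lt_of_le one_pos (one_le_map_matMulTensor hF (by norm_num))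
  calc Real.logb 2 (F (matMulTensor ℂ 2 2 2)) ≤ Real.logb 2 ((2 : ℝ) ^ omega ℂ) :=
        Real.logb_le_logb_of_le one_lt_two h0 h1
    _ = omega ℂ := Real.logb_rpow two_pos (by norm_num)

/-- `τ_F ≤ 3`. -/
theorem matExp_le_three (hF : IsUniversalSpectralPoint ℂ F) :
    Real.logb 2 (F (matMulTensor ℂ 2 2 2)) ≤ 3 :=
  (matExp_le_omega hF).trans (omega_le_three' ℂ)

/-- `F(cw₂) ≥ 3` for every universal spectral point (`= Λ(2)`; the floor at `τ = 2`). -/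
theorem three_le_map_cwTensor (hF : IsUniversalSpectralPoint ℂ F) : 3 ≤ F (cwTensor ℂ 2) := by
  have h := laserFloor_mul hF
  have h1 : (1 : ℝ) ≤ (2 : ℝ) ^ ((Real.logb 2 (F (matMulTensor ℂ 2 2 2)) - 2) / 3) :=
    Real.one_le_rpow one_le_two (by linarith [two_le_matExp hF])
  have h2 : (3 : ℝ) * 1 ≤ 3 * (2 : ℝ) ^ ((Real.logb 2 (F (matMulTensor ℂ 2 2 2)) - 2) / 3) :=
    mul_le_mul_of_nonneg_left h1 (by norm_num)
  linarith

/-! ## 4. `LaserFloorAttained ⟹ LaserMergeOptimal` (BOTTOM_χ ⟹ BOTTOM) -/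

/-- **BOTTOM transported.**  If for every `δ > 0` some universal spectral point has
`log₂ F(cw₂) ≤ (ℓ(ω)/2 + δ) τ_F` (`ℓ(ω) = 2/3 + (2/ω)(log₂3 − 2/3)`), then every restriction
`⟨m,m,m⟩ ≤ cw₂^{⊠N}` has `m² ≤ 2^{(ℓ(ω)+ε)N}` — i.e. `LaserMergeOptimal`.  Proof:
`m^{τ_F} = F(⟨m,m,m⟩) ≤ F(cw₂)^N`, take `log₂`, divide by `τ_F ≥ 2`. -/
theorem laserMergeOptimal_of_attained
    (hA : ∀ δ : ℝ, 0 < δ → ∃ F : SpectralMap ℂ, IsUniversalSpectralPoint ℂ F ∧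
      Real.logb 2 (F (cwTensor ℂ 2)) ≤
        (1 / 3 + (Real.logb 2 3 - 2 / 3) / omega ℂ + δ) * Real.logb 2 (F (matMulTensor ℂ 2 2 2))) :
    LaserMergeOptimal := by
  intro ε hε
  refine ⟨0, fun N _ m hres => ?_⟩
  rcases Nat.eq_zero_or_pos m with hmz | hm0
  · subst hmz
    simp only [Nat.cast_zero, ne_eq, OfNat.ofNat_ne_zero, not_false_eq_true, zero_pow]
    exact (Real.rpow_pos_of_pos two_pos _).le
  obtain ⟨F, hF, hFle⟩ := hA (ε / 2) (half_pos hε)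
  set τ := Real.logb 2 (F (matMulTensor ℂ 2 2 2)) with hτdef
  have hτ2 : 2 ≤ τ := two_le_matExp hF
  have hm1 : 1 ≤ m := hm0
  have hmR : (0 : ℝ) < m := by exact_mod_cast hm0
  have hcw0 : 0 < F (cwTensor ℂ 2) := lt_of_lt_of_le (by norm_num) (three_le_map_cwTensor hF)
  have h1 : (m : ℝ) ^ τ ≤ F (cwTensor ℂ 2) ^ N := by
    have h := hF.mono _ _ hres
    rw [hF.map_kroneckerPow] at h
    exact (rpow_matExp_le_map_matMulTensor hF hm1).trans h
  have h2 : τ * Real.log m ≤ N * Real.log (F (cwTensor ℂ 2)) := by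
    have := Real.log_le_log (Real.rpow_pos_of_pos hmR τ) h1
    rwa [Real.log_rpow hmR, Real.log_pow] at this
  have hL2 : 0 < Real.log 2 := Real.log_pos one_lt_two
  have h3 : Real.log (F (cwTensor ℂ 2)) = Real.logb 2 (F (cwTensor ℂ 2)) * Real.log 2 := by
    rw [Real.logb, div_mul_cancel₀ _ hL2.ne']
  have hN0 : (0 : ℝ) ≤ N := Nat.cast_nonneg N
  have h4 : (N : ℝ) * Real.log (F (cwTensor ℂ 2)) ≤
      N * ((1 / 3 + (Real.logb 2 3 - 2 / 3) / omega ℂ + ε / 2) * τ * Real.log 2) := by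
    rw [h3]
    refine mul_le_mul_of_nonneg_left ?_ hN0
    exact mul_le_mul_of_nonneg_right hFle hL2.le
  have hτ0 : 0 < τ := by linarith
  have h5 : Real.log m ≤ N * (1 / 3 + (Real.logb 2 3 - 2 / 3) / omega ℂ + ε / 2) * Real.log 2 := by
    have key : τ * Real.log m ≤
        τ * (N * (1 / 3 + (Real.logb 2 3 - 2 / 3) / omega ℂ + ε / 2) * Real.log 2) := by
      calc τ * Real.log m ≤ N * Real.log (F (cwTensor ℂ 2)) := h2
        _ ≤ N * ((1 / 3 + (Real.logb 2 3 - 2 / 3) / omega ℂ + ε / 2) * τ * Real.log 2) := h4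
        _ = τ * (N * (1 / 3 + (Real.logb 2 3 - 2 / 3) / omega ℂ + ε / 2) * Real.log 2) := by ring
    exact le_of_mul_le_mul_left key hτ0
  have hgoal : Real.log ((m : ℝ) ^ 2) ≤
      Real.log ((2 : ℝ) ^ ((2 / 3 + 2 / omega ℂ * (Real.logb 2 3 - 2 / 3) + ε) * (N : ℝ))) := by
    rw [Real.log_pow, Real.log_rpow two_pos]
    have e : (2 : ℝ) * (N * (1 / 3 + (Real.logb 2 3 - 2 / 3) / omega ℂ + ε / 2) * Real.log 2) =
        (2 / 3 + 2 / omega ℂ * (Real.logb 2 3 - 2 / 3) + ε) * N * Real.log 2 := by ring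
    push_cast
    linarith
  exact (Real.log_le_log_iff (pow_pos hmR 2) (Real.rpow_pos_of_pos two_pos _)).1 hgoal

/-! ## 6. `LaserFloorStrict ∧ LaserFloorAttained ⟹ ω = 2` -/

/-- `0 < log₂ 3 − 2/3` (indeed `log₂ 3 > 1`). -/
theorem logb_two_three_sub_pos : 0 < Real.logb 2 3 - 2 / 3 := by
  have h : (1 : ℝ) < Real.logb 2 3 := by
    rw [← Real.logb_self_eq_one one_lt_two]
    exact Real.logb_lt_logb one_lt_two two_pos (by norm_num)
  linarith

/-- **The transported cut decides the summit.**  If points with `τ_F ≥ 2 + η` are uniformly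
strictly above the laser floor (`LaserFloorStrict`) and the chord of slope `ℓ(ω)/2` is touched
(`LaserFloorAttained`), then `ω = 2`: for `ω > 2` a touching point either has `τ_F ≥ (ω+2)/2` — then
strictness contradicts touching — or `τ_F < (ω+2)/2` — then the floor itself lies above the chord
by `(log₂3 − 2/3)(ω−2)/(2ω) > 0`. -/
theorem summit_of_laserFloor
    (hB : ∀ η : ℝ, 0 < η → ∃ δ : ℝ, 0 < δ ∧ ∀ F : SpectralMap ℂ, IsUniversalSpectralPoint ℂ F →
      2 + η ≤ Real.logb 2 (F (matMulTensor ℂ 2 2 2)) →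
        Real.logb 2 3 + (Real.logb 2 (F (matMulTensor ℂ 2 2 2)) - 2) / 3 + δ ≤
          Real.logb 2 (F (cwTensor ℂ 2)))
    (hA : ∀ δ : ℝ, 0 < δ → ∃ F : SpectralMap ℂ, IsUniversalSpectralPoint ℂ F ∧
      Real.logb 2 (F (cwTensor ℂ 2)) ≤
        (1 / 3 + (Real.logb 2 3 - 2 / 3) / omega ℂ + δ) * Real.logb 2 (F (matMulTensor ℂ 2 2 2))) :
    _root_.MatrixMultiplication := by
  rw [_root_.MatrixMultiplication_iff]
  have hω2 : 2 ≤ omega ℂ := omega_two_le ℂ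
  have hω3 : omega ℂ ≤ 3 := omega_le_three' ℂ
  by_contra hne
  have hgt : 2 < omega ℂ := lt_of_le_of_ne hω2 (Ne.symm hne)
  have hbL0 : 0 < Real.logb 2 3 - 2 / 3 := logb_two_three_sub_pos
  have hω0 : 0 < omega ℂ := by linarith
  obtain ⟨δ, hδ, hBδ⟩ := hB ((omega ℂ - 2) / 2) (by linarith)
  obtain ⟨u, hu⟩ : ∃ t : ℝ, t = (Real.logb 2 3 - 2 / 3) / omega ℂ := ⟨_, rfl⟩
  have hu0 : 0 < u := by rw [hu]; exact div_pos hbL0 hω0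
  have huω : u * omega ℂ = Real.logb 2 3 - 2 / 3 := by rw [hu]; exact div_mul_cancel₀ _ hω0.ne'
  obtain ⟨K, hK⟩ : ∃ t : ℝ, t = (Real.logb 2 3 - 2 / 3) / 2 - u := ⟨_, rfl⟩
  have hK0 : 0 < K := by
    have : u * 2 < u * omega ℂ := mul_lt_mul_of_pos_left hgt hu0
    rw [hK]; linarith
  obtain ⟨δ', hδ'⟩ : ∃ t : ℝ, t = min (δ / 4) (K / 4) := ⟨_, rfl⟩
  have hδ'0 : 0 < δ' := by rw [hδ']; exact lt_min (by linarith) (by linarith)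
  have hδ'1 : δ' ≤ δ / 4 := by rw [hδ']; exact min_le_left _ _
  have hδ'2 : δ' ≤ K / 4 := by rw [hδ']; exact min_le_right _ _
  obtain ⟨F, hF, hFle⟩ := hA δ' hδ'0
  rw [← hu] at hFle
  have hτ2 := two_le_matExp hF
  have hτω := matExp_le_omega hF
  have hfloor := laserFloor hF
  obtain ⟨τ, hτ⟩ : ∃ t : ℝ, t = Real.logb 2 (F (matMulTensor ℂ 2 2 2)) := ⟨_, rfl⟩
  obtain ⟨x, hx⟩ : ∃ t : ℝ, t = Real.logb 2 (F (cwTensor ℂ 2)) := ⟨_, rfl⟩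
  rw [← hτ, ← hx] at hFle hfloor
  rw [← hτ] at hτ2 hτω
  have hτ3 : τ ≤ 3 := by linarith
  have hδ'τ : δ' * τ ≤ 3 * δ' := by
    have := mul_le_mul_of_nonneg_left hτ3 hδ'0.le
    linarith
  have huτ : u * τ ≤ Real.logb 2 3 - 2 / 3 := by
    calc u * τ ≤ u * omega ℂ := mul_le_mul_of_nonneg_left hτω hu0.le
      _ = _ := huω
  rcases le_or_gt (2 + (omega ℂ - 2) / 2) τ with hcase | hcase
  · -- high matrix exponent: strictness vs touching
    have hs := hBδ F hF (by rw [← hτ]; exact hcase)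
    rw [← hτ, ← hx] at hs
    linarith
  · -- low matrix exponent: the floor itself beats the chord
    have huτ' : u * τ ≤ u * (2 + (omega ℂ - 2) / 2) := mul_le_mul_of_nonneg_left hcase.le hu0.le
    have e : u * (2 + (omega ℂ - 2) / 2) = u + u * omega ℂ / 2 := by ring
    linarith

/-! ## 7. `LaserTangency ⟹ LaserFloorStrict` (LT ⟹ LT_χ) -/

/-- **LT transported.**  Apply `F` to a capped cell of `LaserTangency(s)` with
`2/(2+η) < s < 1`: `F(cw₂)^N ≥ B m^{τ_F}` and `B^s m² ≥ 2^{((2/3)(1−s)−ε)N} 3^{sN}`, `B ≤ 2^{bN}`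
(`b < b_L := log₂3 − 2/3`) give `log₂F(cw₂) ≥ b_L + τ_F/3 + (b_L − b)(sτ_F/2 − 1) − O(ε)`, and
`sτ_F/2 − 1 ≥ η'/4 > 0` once `τ_F ≥ 2 + η`.  The gain `δ = (b_L − b) η' log 2 / 8 · …` is uniform
in `F`. -/
theorem strict_of_laserTangency (hLT : LaserTangency) :
    ∀ η : ℝ, 0 < η → ∃ δ : ℝ, 0 < δ ∧ ∀ F : SpectralMap ℂ, IsUniversalSpectralPoint ℂ F →
      2 + η ≤ Real.logb 2 (F (matMulTensor ℂ 2 2 2)) →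
        Real.logb 2 3 + (Real.logb 2 (F (matMulTensor ℂ 2 2 2)) - 2) / 3 + δ ≤
          Real.logb 2 (F (cwTensor ℂ 2)) := by
  intro η hη
  have hL2 : 0 < Real.log 2 := Real.log_pos one_lt_two
  have hL2' : Real.log 2 ≤ 1 := by
    have h := Real.add_one_le_exp (1 : ℝ)
    have h2 : (2 : ℝ) ≤ Real.exp 1 := by linarith
    calc Real.log 2 ≤ Real.log (Real.exp 1) := Real.log_le_log two_pos h2
      _ = 1 := Real.log_exp 1
  have hL3 : 0 < Real.log 3 := Real.log_pos (by norm_num)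
  have hL : Real.logb 2 3 * Real.log 2 = Real.log 3 := by
    rw [Real.logb, div_mul_cancel₀ _ hL2.ne']
  -- `η' = min η 1`, `s = (2 + η'/2)/(2 + η')`, `c = η'/4`
  obtain ⟨η', hη'⟩ : ∃ t : ℝ, t = min η 1 := ⟨_, rfl⟩
  have hη'0 : 0 < η' := by rw [hη']; exact lt_min hη one_pos
  have hη'1 : η' ≤ 1 := by rw [hη']; exact min_le_right _ _
  have hη'η : η' ≤ η := by rw [hη']; exact min_le_left _ _
  have h2η : (0 : ℝ) < 2 + η' := by linarith
  obtain ⟨s, hs⟩ : ∃ t : ℝ, t = (2 + η' / 2) / (2 + η') := ⟨_, rfl⟩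
  have hs0 : 0 < s := by rw [hs]; exact div_pos (by linarith) h2η
  have hs1 : s < 1 := by
    rw [hs, div_lt_one h2η]; linarith
  have hsc : s * (2 + η') = 2 + η' / 2 := by
    rw [hs]; field_simp
  obtain ⟨b, hb, hP⟩ := hLT s hs0 hs1
  obtain ⟨Γ, hΓ⟩ : ∃ G : ℝ, G = Real.log 3 - 2 / 3 * Real.log 2 - b * Real.log 2 := ⟨_, rfl⟩
  have hΓ0 : 0 < Γ := by
    have h1 : b * Real.log 2 < (Real.logb 2 3 - 2 / 3) * Real.log 2 :=
      mul_lt_mul_of_pos_right hb hL2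
    rw [hΓ]; linarith
  obtain ⟨c, hc⟩ : ∃ t : ℝ, t = η' / 4 := ⟨_, rfl⟩
  have hc0 : 0 < c := by rw [hc]; linarith
  have hΓc : 0 < Γ * c := mul_pos hΓ0 hc0
  refine ⟨Γ * c / 2, by linarith, fun F hF hτη => ?_⟩
  obtain ⟨τ, hτ⟩ : ∃ t : ℝ, t = Real.logb 2 (F (matMulTensor ℂ 2 2 2)) := ⟨_, rfl⟩
  rw [← hτ] at hτη ⊢
  have hτ3 : τ ≤ 3 := by rw [hτ]; exact matExp_le_three hF
  have hτη' : 2 + η' ≤ τ := by linarith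
  have hPc : 1 + c ≤ s * τ / 2 := by
    have : s * (2 + η') ≤ s * τ := mul_le_mul_of_nonneg_left hτη' hs0.le
    rw [hsc] at this
    rw [hc]; linarith
  -- the cell at accuracy `ε = Γ c / 3`, length `N ≥ 1`
  obtain ⟨N, hN, B, m, hres, hcap, hA⟩ := hP (Γ * c / 3) (by linarith) 1
  have hn1 : (1 : ℝ) ≤ N := by exact_mod_cast hN
  have hn0 : (0 : ℝ) < N := by linarith
  have lhs_pos : (0 : ℝ) < (2 : ℝ) ^ ((2 / 3 * (1 - s) - Γ * c / 3) * N) * (3 : ℝ) ^ (s * N) :=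
    mul_pos (Real.rpow_pos_of_pos two_pos _) (Real.rpow_pos_of_pos (by norm_num) _)
  have hB1 : 1 ≤ B := by
    rcases Nat.eq_zero_or_pos B with h | h
    · exfalso
      rw [h, Nat.cast_zero, Real.zero_rpow hs0.ne', zero_mul] at hA
      exact absurd hA (not_le.mpr lhs_pos)
    · exact h
  have hB0 : (0 : ℝ) < B := by exact_mod_cast hB1
  have hm1 : 1 ≤ m := by
    rcases Nat.eq_zero_or_pos m with h | h
    · exfalso
      rw [h, Nat.cast_zero] at hA
      have : (B : ℝ) ^ s * (0 : ℝ) ^ 2 = 0 := by simp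
      rw [this] at hA
      exact absurd hA (not_le.mpr lhs_pos)
    · exact h
  have hm0 : (0 : ℝ) < m := by exact_mod_cast hm1
  -- apply `F`
  have hFN := mul_rpow_le_pow_of_packing hF hm1 hres
  rw [← hτ] at hFN
  have hcw0 : 0 < F (cwTensor ℂ 2) := lt_of_lt_of_le (by norm_num) (three_le_map_cwTensor hF)
  obtain ⟨X, hX⟩ : ∃ t : ℝ, t = Real.log (F (cwTensor ℂ 2)) := ⟨_, rfl⟩
  obtain ⟨LB, hLB⟩ : ∃ t : ℝ, t = Real.log (B : ℝ) := ⟨_, rfl⟩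
  obtain ⟨LM, hLM⟩ : ∃ t : ℝ, t = Real.log (m : ℝ) := ⟨_, rfl⟩
  have h4 : LB + τ * LM ≤ N * X := by
    have h := Real.log_le_log (mul_pos hB0 (Real.rpow_pos_of_pos hm0 τ)) hFN
    rw [Real.log_mul hB0.ne' (Real.rpow_pos_of_pos hm0 τ).ne', Real.log_rpow hm0,
      Real.log_pow] at h
    rw [hLB, hLM, hX]; exact h
  -- the cell inequality in logarithms
  have hAL : (2 / 3 * (1 - s) - Γ * c / 3) * N * Real.log 2 + s * N * Real.log 3 ≤
      s * LB + 2 * LM := by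
    have h1 : Real.log ((2 : ℝ) ^ ((2 / 3 * (1 - s) - Γ * c / 3) * N) * (3 : ℝ) ^ (s * N)) ≤
        Real.log ((B : ℝ) ^ s * (m : ℝ) ^ 2) := Real.log_le_log lhs_pos hA
    rw [Real.log_mul (Real.rpow_pos_of_pos two_pos _).ne' (Real.rpow_pos_of_pos (by norm_num) _).ne',
      Real.log_rpow two_pos, Real.log_rpow (by norm_num : (0 : ℝ) < 3),
      Real.log_mul (Real.rpow_pos_of_pos hB0 _).ne' (pow_pos hm0 2).ne',
      Real.log_rpow hB0, Real.log_pow] at h1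
    rw [hLB, hLM]
    push_cast at h1 ⊢
    linarith
  have hcapL : LB ≤ b * N * Real.log 2 := by
    have h1 : Real.log (B : ℝ) ≤ Real.log ((2 : ℝ) ^ (b * N)) := Real.log_le_log hB0 hcap
    rw [Real.log_rpow two_pos] at h1
    rw [hLB]; exact h1
  -- products
  have hτ0 : 0 ≤ τ / 2 := by linarith
  have h6 : τ / 2 * ((2 / 3 * (1 - s) - Γ * c / 3) * N * Real.log 2 + s * N * Real.log 3) ≤
      τ / 2 * (s * LB + 2 * LM) := mul_le_mul_of_nonneg_left hAL hτ0
  have hneg : 1 - s * τ / 2 ≤ 0 := by linarith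
  have h7 : b * N * Real.log 2 * (1 - s * τ / 2) ≤ LB * (1 - s * τ / 2) :=
    mul_le_mul_of_nonpos_right hcapL hneg
  have g1 : Γ * c ≤ Γ * (s * τ / 2 - 1) := mul_le_mul_of_nonneg_left (by linarith) hΓ0.le
  have g2 : Γ * c / 2 * Real.log 2 ≤ Γ * c / 2 := mul_le_of_le_one_right (by linarith) hL2'
  have g3 : τ / 2 * (Γ * c / 3) * Real.log 2 ≤ Γ * c / 2 := by
    have a0 : 0 ≤ Γ * c / 3 := by linarith
    have a1 : τ / 2 * (Γ * c / 3) ≤ 3 / 2 * (Γ * c / 3) :=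
      mul_le_mul_of_nonneg_right (by linarith) a0
    have a2 : τ / 2 * (Γ * c / 3) * Real.log 2 ≤ τ / 2 * (Γ * c / 3) * 1 :=
      mul_le_mul_of_nonneg_left hL2' (mul_nonneg hτ0 a0)
    linarith
  have g1N := mul_le_mul_of_nonneg_left g1 hn0.le
  have g2N := mul_le_mul_of_nonneg_left g2 hn0.le
  have g3N := mul_le_mul_of_nonneg_left g3 hn0.le
  have eΓN : (N : ℝ) * Γ = N * Real.log 3 - 2 / 3 * N * Real.log 2 - b * N * Real.log 2 := by
    rw [hΓ]; ring
  have eΓsτN : (N : ℝ) * (s * τ / 2) * Γ =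
      s * τ / 2 * N * Real.log 3 - s * τ / 3 * N * Real.log 2 -
        s * τ / 2 * (b * N * Real.log 2) := by
    rw [hΓ]; ring
  have hmain : (N : ℝ) * (Real.log 3 + (τ - 2) / 3 * Real.log 2 + Γ * c / 2 * Real.log 2) ≤
      N * X := by
    linarith only [h4, h6, h7, g1N, g2N, g3N, eΓN, eΓsτN]
  have hmain' : Real.log 3 + (τ - 2) / 3 * Real.log 2 + Γ * c / 2 * Real.log 2 ≤ X :=
    le_of_mul_le_mul_left hmain hn0
  have hfin : (Real.logb 2 3 + (τ - 2) / 3 + Γ * c / 2) * Real.log 2 ≤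
      Real.logb 2 (F (cwTensor ℂ 2)) * Real.log 2 := by
    have e3 : Real.logb 2 (F (cwTensor ℂ 2)) * Real.log 2 = X := by
      rw [hX, Real.logb, div_mul_cancel₀ _ hL2.ne']
    rw [e3]
    linarith [hmain', hL]
  exact le_of_mul_le_mul_right hfin hL2

/-- The HYBRID cut: the crux of record `LaserTangency` together with the spectral (chord) form of
laser-merge optimality already forces `ω = 2` — `LaserTangency → LaserFloorAttained → ω = 2`. -/
theorem summit_of_laserTangency_of_attained (hLT : LaserTangency)
    (hA : ∀ δ : ℝ, 0 < δ → ∃ F : SpectralMap ℂ, IsUniversalSpectralPoint ℂ F ∧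
      Real.logb 2 (F (cwTensor ℂ 2)) ≤
        (1 / 3 + (Real.logb 2 3 - 2 / 3) / omega ℂ + δ) * Real.logb 2 (F (matMulTensor ℂ 2 2 2))) :
    _root_.MatrixMultiplication :=
  summit_of_laserFloor (strict_of_laserTangency hLT) hA

end Summit.MatrixMultiplication.MatrixMultiplication.Theorems.OutsiderSandwichLaserFloorCut
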